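import Literature.AlgebraicGeometry.Morphisms.FormalModuleTower
import Literature.AlgebraicGeometry.Modules.EpiChainStabilizes
import HarnessLib

/-!
# The graded pieces `aⁿ⁺¹ℱ_{n+1} = ker(ℱ_{n+1} → ℱ_n)` of a coherent formal module take finitely many values

For a formal tower `F` along a global function `a` (`Morphisms/FormalModuleTower`: `aⁿ⁺¹F_n = 0`,
`F_n = F_{n+1}/aⁿ⁺¹F_{n+1}`) the kernels `gr_n F = ker(F_{n+1} → F_n) = aⁿ⁺¹F_{n+1}` are the graded
pieces of the `a`-adic filtration. This file shows that they form a CHAIN OF QUOTIENTS OF `F_0`: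

* `grψ n : F_{n+1} ↠ gr_n F` — multiplication by `aⁿ⁺¹` (an epimorphism, by exactness);
* `globalScalar_kernel_map_eq_zero` — `aⁿ⁺¹` kills `ker(F_{n+1} → F_0)` (induction on `n`, purely
  diagrammatic), so `grψ n` descends to `grψ₀ n : F_0 ↠ gr_n F`;
* `grμ n : gr_n F ↠ gr_{n+1} F` — "multiplication by `a`", with `grψ₀ n ≫ grμ n = grψ₀ (n + 1)`;
* `exists_forall_isIso_grμ`, `exists_forall_iso_gr` — **on a noetherian scheme, for a formal tower of
  coherent modules, `grμ n` is an isomorphism for `n ≫ 0`; in particular the `gr_n F` take finitely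
  many isomorphism classes** (`Modules/EpiChainStabilizes`).

This is the finiteness that makes Serre-type vanishing and generation statements UNIFORM in `n` for
the levels of a coherent formal module along a principal ideal (Görtz–Wedhorn II Prop. 24.102; for a
general ideal of definition one uses instead that `⊕ₙ gr_n` is coherent over `gr_I 𝒪_X`).
Everything is proved; no named facts.

## References

* U. Görtz, T. Wedhorn, *Algebraic Geometry II* (2023), Prop. 24.102 and its proof (p. 569).
  [GortzWedhorn2023]
* A. Grothendieck, EGA III₁ (1961), 5.2–5.3. [EGAIII1]
-/

noncomputable section

open CategoryTheory AlgebraicGeometry Limits TopologicalSpace Opposite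
open Literature.AlgebraicGeometry.Modules

universe u

namespace Literature.AlgebraicGeometry.Morphisms

variable {X : Scheme.{u}} {a : Γ(X, ⊤)} {F : ℕᵒᵖ ⥤ X.Modules} (hF : IsFormalTower a F)

namespace IsFormalTower

/-! ### The graded pieces and multiplication by `aⁿ⁺¹` -/

/-- The graded piece `gr_n F = ker(F_{n+1} → F_n)` (`= aⁿ⁺¹F_{n+1}`). [cite: GortzWedhorn2023, Prop. 24.102, proof (p. 569)] -/
abbrev gr (_hF : IsFormalTower a F) (n : ℕ) : X.Modules := kernel (towerπ F n)

/-- **Multiplication by `aⁿ⁺¹`, `F_{n+1} ↠ gr_n F`.** [cite: GortzWedhorn2023, Prop. 24.102, proof (p. 569)] -/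
def grψ (n : ℕ) : F.obj ⟨n + 1⟩ ⟶ hF.gr n :=
  kernel.lift (towerπ F n) (globalScalar (F.obj ⟨n + 1⟩) (a ^ (n + 1)))
    (globalScalar_comp_towerπ F n _ (hF.killed n))

/-- `grψ n` followed by the inclusion is multiplication by `aⁿ⁺¹`. [folklore] -/
@[reassoc (attr := simp)]
theorem grψ_ι (n : ℕ) : hF.grψ n ≫ kernel.ι (towerπ F n) = globalScalar (F.obj ⟨n + 1⟩) (a ^ (n + 1)) :=
  kernel.lift_ι _ _ _

/-- `grψ n` is an epimorphism (exactness of `F_{n+1} —aⁿ⁺¹→ F_{n+1} → F_n`). [folklore] -/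
instance epi_grψ (n : ℕ) : Epi (hF.grψ n) := (hF.exact n).epi_kernelLift

/-- `a` kills `gr_n F = aⁿ⁺¹F_{n+1}` (as `aⁿ⁺²F_{n+1} = 0`). [folklore] -/
theorem globalScalar_gr_eq_zero (n : ℕ) : globalScalar (hF.gr n) a = 0 := by
  rw [← cancel_epi (hF.grψ n), ← globalScalar_comp, comp_zero,
    ← cancel_mono (kernel.ι (towerπ F n)), Category.assoc, grψ_ι, zero_comp, ← globalScalar_mul,
    ← pow_succ, hF.killed (n + 1)]

include hF in
/-- If `j ≫ aˣ` dies in `F_n` (i.e. factors through `gr_n F`, on which `a` is zero), then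
`j ≫ aˣ⁺¹ = 0`. [folklore] -/
theorem comp_globalScalar_pow_succ_eq_zero (n x : ℕ) {A : X.Modules} (j : A ⟶ F.obj ⟨n + 1⟩)
    (hj : j ≫ globalScalar (F.obj ⟨n + 1⟩) (a ^ x) ≫ towerπ F n = 0) :
    j ≫ globalScalar (F.obj ⟨n + 1⟩) (a ^ (x + 1)) = 0 := by
  have hfac : j ≫ globalScalar (F.obj ⟨n + 1⟩) (a ^ x) =
      kernel.lift (towerπ F n) (j ≫ globalScalar (F.obj ⟨n + 1⟩) (a ^ x))
        (by rw [Category.assoc, hj]) ≫ kernel.ι (towerπ F n) := (kernel.lift_ι _ _ _).symm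
  rw [pow_succ', globalScalar_mul, ← Category.assoc, hfac, Category.assoc,
    ← globalScalar_comp (kernel.ι (towerπ F n)) a, hF.globalScalar_gr_eq_zero, zero_comp, comp_zero]

include hF in
/-- **`aⁿ⁺¹` kills `ker(F_{n+1} → F_0)`** (induction on `n`: the image of the kernel in `F_n` lies
in `ker(F_n → F_0)`, killed by `aⁿ`, so `aⁿ ·` the kernel dies in `F_n`, and one more `a` kills
it). [cite: GortzWedhorn2023, (24.18.1) (p. 562)] -/
theorem globalScalar_kernel_map_eq_zero :
    ∀ n : ℕ, kernel.ι (F.map (homOfLE (Nat.zero_le (n + 1))).op) ≫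
      globalScalar (F.obj ⟨n + 1⟩) (a ^ (n + 1)) = 0
  | 0 => by
    apply hF.comp_globalScalar_pow_succ_eq_zero 0 0
    rw [pow_zero, globalScalar_one, Category.id_comp]
    exact kernel.condition _
  | n + 1 => by
    apply hF.comp_globalScalar_pow_succ_eq_zero (n + 1) (n + 1)
    -- the image of the kernel in `F_{n+1}` lies in `ker(F_{n+1} → F_0)`
    have hcomp : (homOfLE (Nat.zero_le (n + 1 + 1))).op =
        (homOfLE (Nat.le_succ (n + 1))).op ≫ (homOfLE (Nat.zero_le (n + 1))).op :=
      Subsingleton.elim _ _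
    have h0 : (kernel.ι (F.map (homOfLE (Nat.zero_le (n + 1 + 1))).op) ≫ towerπ F (n + 1)) ≫
        F.map (homOfLE (Nat.zero_le (n + 1))).op = 0 := by
      rw [Category.assoc, ← F.map_comp, ← hcomp, kernel.condition]
    have hfac : kernel.ι (F.map (homOfLE (Nat.zero_le (n + 1 + 1))).op) ≫ towerπ F (n + 1) =
        kernel.lift _ _ h0 ≫ kernel.ι (F.map (homOfLE (Nat.zero_le (n + 1))).op) :=
      (kernel.lift_ι _ _ _).symm
    rw [globalScalar_comp, ← Category.assoc, hfac, Category.assoc,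
      globalScalar_kernel_map_eq_zero n, comp_zero]

include hF in
/-- All the maps `F_m → F_0` are epimorphisms. [folklore] -/
theorem epi_map_zero (n : ℕ) : Epi (F.map (homOfLE (Nat.zero_le n)).op) := hF.epi_map _

/-- `grψ n` kills `ker(F_{n+1} → F_0)`. [folklore] -/
theorem kernel_ι_map_comp_grψ (n : ℕ) :
    kernel.ι (F.map (homOfLE (Nat.zero_le (n + 1))).op) ≫ hF.grψ n = 0 := by
  rw [← cancel_mono (kernel.ι (towerπ F n)), Category.assoc, grψ_ι, zero_comp,
    hF.globalScalar_kernel_map_eq_zero]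

/-- **Multiplication by `aⁿ⁺¹` as a map `F_0 ↠ gr_n F`** (descent of `grψ n` along
`F_{n+1} ↠ F_0`, whose kernel is killed by `aⁿ⁺¹`). [cite: GortzWedhorn2023, Prop. 24.102, proof (p. 569)] -/
def grψ₀ (n : ℕ) : F.obj ⟨0⟩ ⟶ hF.gr n :=
  haveI := hF.epi_map_zero (n + 1)
  Abelian.epiDesc (F.map (homOfLE (Nat.zero_le (n + 1))).op) (hF.grψ n) (hF.kernel_ι_map_comp_grψ n)

/-- The defining property of `grψ₀`. [folklore] -/
@[reassoc (attr := simp)]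
theorem map_grψ₀ (n : ℕ) : F.map (homOfLE (Nat.zero_le (n + 1))).op ≫ hF.grψ₀ n = hF.grψ n := by
  haveI := hF.epi_map_zero (n + 1)
  exact Abelian.comp_epiDesc _ _ (hF.kernel_ι_map_comp_grψ n)

/-- `grψ₀ n` is an epimorphism. [folklore] -/
theorem epi_grψ₀ (n : ℕ) : Epi (hF.grψ₀ n) :=
  epi_of_epi_fac (hF.map_grψ₀ n)

/-! ### The chain maps `gr_n F ↠ gr_{n+1} F` -/

/-- The epimorphism `F_{n+2} ↠ F_{n+1} ↠ gr_n F`. [folklore] -/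
abbrev grp (n : ℕ) : F.obj ⟨n + 1 + 1⟩ ⟶ hF.gr n := towerπ F (n + 1) ≫ hF.grψ n

/-- `grp n` is an epimorphism. [folklore] -/
instance epi_grp (n : ℕ) : Epi (hF.grp n) := by
  haveI := hF.epi (n + 1)
  exact epi_comp _ _

/-- `aⁿ⁺²` kills `ker(F_{n+2} ↠ gr_n F)`: an `x` with `aⁿ⁺¹π(x) = 0` has `aⁿ⁺¹x ∈ ker π`, which
`a` kills. [folklore] -/
theorem kernel_ι_grp_comp_globalScalar (n : ℕ) :
    kernel.ι (hF.grp n) ≫ globalScalar (F.obj ⟨n + 1 + 1⟩) (a ^ (n + 1 + 1)) = 0 := by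
  apply hF.comp_globalScalar_pow_succ_eq_zero (n + 1) (n + 1)
  rw [globalScalar_comp, ← hF.grψ_ι, ← Category.assoc (towerπ F (n + 1)), kernel.condition_assoc,
    zero_comp]

/-- **"Multiplication by `a`", `gr_n F ↠ gr_{n+1} F`** (descent of `grψ (n+1)` along
`F_{n+2} ↠ gr_n F`). [cite: GortzWedhorn2023, Prop. 24.102, proof (p. 569)] -/
def grμ (n : ℕ) : hF.gr n ⟶ hF.gr (n + 1) :=
  Abelian.epiDesc (hF.grp n) (hF.grψ (n + 1)) (by
    rw [← cancel_mono (kernel.ι (towerπ F (n + 1))), Category.assoc, grψ_ι, zero_comp,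
      hF.kernel_ι_grp_comp_globalScalar])

/-- The defining property of `grμ`. [folklore] -/
@[reassoc (attr := simp)]
theorem grp_grμ (n : ℕ) : hF.grp n ≫ hF.grμ n = hF.grψ (n + 1) :=
  Abelian.comp_epiDesc _ _ _

/-- **The graded pieces form a chain of quotients of `F_0`.** [cite: GortzWedhorn2023, Prop. 24.102, proof (p. 569)] -/
@[reassoc]
theorem grψ₀_grμ (n : ℕ) : hF.grψ₀ n ≫ hF.grμ n = hF.grψ₀ (n + 1) := by
  haveI := hF.epi_map_zero (n + 1 + 1)
  rw [← cancel_epi (F.map (homOfLE (Nat.zero_le (n + 1 + 1))).op), map_grψ₀, ← grp_grμ]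
  have hcomp : (homOfLE (Nat.zero_le (n + 1 + 1))).op =
      (homOfLE (Nat.le_succ (n + 1))).op ≫ (homOfLE (Nat.zero_le (n + 1))).op :=
    Subsingleton.elim _ _
  rw [hcomp, F.map_comp, Category.assoc, map_grψ₀_assoc]
  exact (Category.assoc _ _ _).symm

/-! ### Finiteness on a noetherian scheme -/

variable [IsLocallyNoetherian X] [CompactSpace X] (hFc : ∀ n, Coh (F.obj ⟨n⟩))

omit [CompactSpace X] in
include hFc in
/-- The graded pieces are coherent. [cite: Hartshorne1977, II Prop. 5.7 (p. 114)] -/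
theorem coh_gr (n : ℕ) : Coh (hF.gr n) := Coh.kernel _ (hFc _) (hFc _)

include hFc in
/-- **The chain `gr_0 F ↠ gr_1 F ↠ ⋯` of quotients of the coherent `F_0` stabilises** on a
noetherian scheme: `grμ n` is an isomorphism for `n ≫ 0`. [cite: GortzWedhorn2023, Prop. 24.102, proof (p. 569)] -/
theorem exists_forall_isIso_grμ : ∃ n₀, ∀ n, n₀ ≤ n → IsIso (hF.grμ n) :=
  exists_forall_isIso_of_epi_chain (hFc 0) (G := hF.gr) (hF.coh_gr hFc) hF.grψ₀
    (fun n => hF.epi_grψ₀ n) hF.grμ hF.grψ₀_grμ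

include hFc in
/-- **The graded pieces of a coherent formal module take finitely many values**: for `n ≥ n₀`,
`gr_n F ≅ gr_{n₀} F`. [cite: GortzWedhorn2023, Prop. 24.102, proof (p. 569)] -/
theorem exists_forall_iso_gr : ∃ n₀, ∀ n, n₀ ≤ n → Nonempty (hF.gr n₀ ≅ hF.gr n) := by
  obtain ⟨n₀, h⟩ := hF.exists_forall_isIso_grμ hFc
  refine ⟨n₀, fun n hn => ?_⟩
  obtain ⟨d, rfl⟩ := Nat.exists_eq_add_of_le hn
  induction d with
  | zero => exact ⟨Iso.refl _⟩
  | succ d ih =>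
    obtain ⟨e⟩ := ih (Nat.le_add_right n₀ d)
    haveI := h (n₀ + d) (Nat.le_add_right n₀ d)
    exact ⟨e ≪≫ asIso (hF.grμ (n₀ + d))⟩

include hFc in
/-- **Uniformity from finiteness**: a property of modules that is invariant under isomorphism
and holds for each graded piece `gr_n F` for all large `m` holds for ALL graded pieces for all `m`
beyond ONE bound (finitely many isomorphism classes).
This is how Serre-type vanishing / generation statements for the twists `gr_n F(m)` become uniform
in `n`. [cite: GortzWedhorn2023, Prop. 24.102, proof (p. 569)] -/
theorem exists_uniform_gr (P : X.Modules → ℕ → Prop)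
    (hPiso : ∀ {M N : X.Modules}, (M ≅ N) → ∀ m, P M m → P N m)
    (hP : ∀ n, ∃ m₀, ∀ m, m₀ ≤ m → P (hF.gr n) m) :
    ∃ m₀, ∀ n m, m₀ ≤ m → P (hF.gr n) m := by
  classical
  obtain ⟨n₀, hn₀⟩ := hF.exists_forall_iso_gr hFc
  choose mP hmP using hP
  refine ⟨(Finset.range (n₀ + 1)).sup mP, fun n m hm => ?_⟩
  by_cases hn : n ≤ n₀
  · exact hmP n m (le_trans (Finset.le_sup (Finset.mem_range.mpr (Nat.lt_succ_of_le hn))) hm)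
  · obtain ⟨e⟩ := hn₀ n (le_of_lt (not_le.mp hn))
    exact hPiso e m (hmP n₀ m
      (le_trans (Finset.le_sup (Finset.mem_range.mpr (Nat.lt_succ_self n₀))) hm))

end IsFormalTower

end Literature.AlgebraicGeometry.Morphisms

end
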